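import Summits.BirchSwinnertonDyer.Rank1Residual.Additive.CensusQ6RankOneInterlock
import Summits.BirchSwinnertonDyer.Rank1Residual.Additive.GordRankOneKatoCertificateThreeBSD
import HarnessLib

/-!
# Census records, rank one, (G-ord, `e = 2`): the Q6 record at index `1` IS the one-number certificate
# — `CensusQ6.Gord[Odd]FirstUnitIndexAt W p 1 ⟺ BranchUnitCertificateAt W p` when `L(E,1) = 0` — and
# the ODD branch needs NO Pal input (cell `b2b-bsdres`, team n1011, seat n1011-p06 gen 3 = the Q6
# register seat, `cells/n1011/PREDICTIONS-Q6.md`; the (G-ord) twin of n1011-p12's (M)-locus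
# `multBranchUnitCertificateAt_of_firstUnitIndex_one_of_mod_four_eq_three` /
# `multOddFirstUnitIndexAt_one_of_norm_minusCoeff_one`, file `PotMultRankOneKatoCertificateBSDOdd.lean`)

HONEST FRAMING (cell `b2b-bsdres`, run/shared/lean/b2b/bsd-rank1-residual/, verbatim in every
file): the goal of the cell is to DELETE the COMBINATION-SHAPED residual classes of the
Birch–Swinnerton-Dyer formula for ALL analytic-rank `≤ 1` elliptic curves over `ℚ` — "full BSD
formula for every rank `≤ 1` curve in class `C`" assembled STRICTLY from published theorems — so
that the rank-`≤ 1` remainder becomes exactly the CONSTRUCTION-SHAPED classes, which are TYPED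
(missing-input `Prop`s), NOT attempted. This is not "finishing BSD". Team n1011 (RESIDUAL-MAP §I
O7-ord / N10 (G-ord) share): prove what is provable now; shrink each hard class to its core with data;
no claim beyond stated classes; research routes; census output = EVIDENCE / per-pair
CERTIFICATE-EVIDENCE, never a Literature fact; RESIDUAL-MAP marks change only by signed lines. §I O7
stays OPEN; X4♯(G-ord) stays CONSTRUCTION-SHAPED; nothing is booked; no label changes. THEOREMS ONLY
(no definition, no named fact); named facts enter as HYPOTHESES (modularity `hmod`, Pal 2012 Thm. 3.2
`hPal` on the EVEN branch only, Kato 2004 Thm. 17.4 (3) `hK`, GZK `hGZK`, a Delbourgo (B)-datum `hB`);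
the census inputs are HYPOTHESES (`CensusQ6.Gord[Odd]FirstUnitIndexAt W p 1` = CERTIFICATE-EVIDENCE,
two engines per PREDICTIONS-Q6; `CensusX42.RelationAt W p Dh` = CANDIDATE).

## What and why

census-ctyper1's interlock `branchUnitCertificateAt_of_gordFirstUnitIndexAt_one[_odd]`
(`CensusQ6RankOneInterlock.lean` §1) turns the Q6 record "first `p`-adic unit coefficient of the
Néron-normalised branch `ϖ·B^±_{(p−1)/2}(f♭, α♭)` at index `1`" + `L(E,1) = 0` into additive-p2's
`BranchUnitCertificateAt W p` (constant term `0` + unit linear coefficient) — carrying `hPal` on BOTH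
branches because it goes through the parity-uniform `branchUnitCertificateAt_of_norm_coeff_one`. Two
bookkeeping points were left open on the (G-ord) locus (both settled on (M) by n1011-p12):

* §1 **ODD branch, Pal-free**: `branchUnitCertificateAt_of_gordOddFirstUnitIndexAt_one_of_mod_four_eq_three`
  — the same interlock over n1011-p12's Pal-free `branchUnitCertificateAt_of_norm_coeff_one_odd`
  (`p ≡ 3 (mod 4)`, `p = 3` included; Birch for `d = −p < 0` is a tree theorem). So every ODD (G-ord)
  record consumer can drop `hPal` (e.g. the `p ≥ 7` odd CERT-iff records of r3's GAP (e)).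
* §1–§2 **CONVERSELY the record's `m = 0` clause is AUTOMATIC from the certificate** (its constant term
  IS `0`, of norm `0 < 1`): `gord[Odd]FirstUnitIndexAt_one_of_branchUnitCertificateAt` (no `L(E,1)`,
  no Pal, either branch), hence `CensusQ6.GordOddFirstUnitIndexAt W p 1 ↔ BranchUnitCertificateAt W p`
  given `L(E,1) = 0` (Pal-free) and `CensusQ6.GordFirstUnitIndexAt W p 1 ↔ BranchUnitCertificateAt W p`
  given `L(E,1) = 0` and `hPal` — on `r_an ≥ 1` rows the Q6 register's PASS record at `n₀ = 1` and the
  rank-one chain's certificate are ONE datum (PREDICTIONS-Q6 §5 P1 ↔ additive-p2's `hcert`).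
* §3 the Pal-free ODD two-record node `ClassX4Gord.bsdp_of_censusX42_of_katoHalf_of_gordOddFirstUnitIndexAt_one`
  (twin of census-ctyper1's `…_of_gordFirstUnitIndexAt_one_odd` WITHOUT `hPal`).

Nothing about any curve is asserted; EVIDENCE-conditional on the census inputs; nothing booked.

References: B. Mazur, J. Tate, J. Teitelbaum, Invent. Math. 84 (1986) §I.13–I.14
[MazurTateTeitelbaum1986Invent]; A. Pal, Proc. AMS 140 (2012) Thm. 3.2 [Pal2012]; K. Kato, Astérisque
295 (2004) Thm. 17.4 (3) [Kato2004Asterisque]; D. Delbourgo, J. Number Theory 95 (2002) Thm. (B)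
[Delbourgo2002]; R. L. Miller, LMS J. Comput. Math. 14 (2011) Def. 1.1 [Miller2011LMS];
HOME/cells/n1011/PREDICTIONS-Q6.md (register; EVIDENCE).
-/

noncomputable section

open scoped Classical MatrixGroups ModularForm NumberField

namespace Summit.BirchSwinnertonDyer.Rank1Residual.Additive

open CongruenceSubgroup WeierstrassCurve NumberField Literature.NumberTheory.EllipticCurves
  Literature.NumberTheory.EllipticCurves.ModularForms
  Literature.NumberTheory.EllipticCurves.Rank1Residual
  Literature.NumberTheory.EllipticCurves.Rank1Residual.Typed
  Literature.NumberTheory.EllipticCurves.Delbourgo2002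
  Literature.NumberTheory.GaloisRepresentations Summit.BirchSwinnertonDyer.Rank1Residual.AdditivePotMult
  IsDedekindDomain

variable {W : WeierstrassCurve ℚ} [W.IsElliptic] [W.IsGloballyMinimal] {p : ℕ} [hp : Fact p.Prime]

/-! ### §1 ODD branch (`p ≡ 3 (mod 4)`, `p = 3` included): record at index `1` ⟺ certificate, NO Pal -/

/-- **Q6 INTERLOCK, (G-ord), odd branch, Pal-free**: census-ctyper1's record
`CensusQ6.GordOddFirstUnitIndexAt W p 1` ("the first `p`-adic unit coefficient of
`ϖ⁻·L_p⁻(f♭, α♭, ω^{(p−1)/2}, T)` sits at index `1`") and `L(E,1) = 0` ⟹ additive-p2's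
`BranchUnitCertificateAt W p` — over n1011-p12's `branchUnitCertificateAt_of_norm_coeff_one_odd` (Birch
for the twist by `−p < 0` is a tree theorem), so NO `hPal` (twin of census-ctyper1's
`branchUnitCertificateAt_of_gordFirstUnitIndexAt_one_odd`, which carries the idle `hPal`).
[cite: MazurTateTeitelbaum1986Invent, §I.13–I.14] -/
theorem branchUnitCertificateAt_of_gordOddFirstUnitIndexAt_one_of_mod_four_eq_three
    (hmod : hasEntireLFunction_rat) (hp4 : p % 4 = 3) (hadd : Addv W p) (hL : W.entireLFunction 1 = 0)
    (hrec : CensusQ6.GordOddFirstUnitIndexAt W p 1) : BranchUnitCertificateAt W p := by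
  have hodd : ¬ Even (p / 2) := by rw [Nat.not_even_iff_odd]; exact ⟨p / 4, by omega⟩
  refine branchUnitCertificateAt_of_norm_coeff_one_odd hmod hp4 hadd hL ?_
  intro V _ _ C hC hord N _ f hf ϖ hϖ
  have hC' : C • V.quadraticTwist (-(p : ℚ)) = W := by
    rw [pStar_eq_neg_of_mod_four_eq_three hp4] at hC; exact hC
  rw [if_neg hodd] at hϖ ⊢
  exact (hrec V C hord hC' f hf ϖ hϖ).2

omit [W.IsElliptic] [W.IsGloballyMinimal] in
/-- **Conversely (odd branch): the certificate ⟹ the Q6 record at index `1`** — NO `L(E,1)`, NO Pal: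
the certificate's constant term IS `0` (norm `0 < 1` = the record's `m = 0` clause) and its linear
coefficient has norm `1`. [cite: MazurTateTeitelbaum1986Invent, §I.13–I.14] -/
theorem gordOddFirstUnitIndexAt_one_of_branchUnitCertificateAt (hp4 : p % 4 = 3)
    (hcert : BranchUnitCertificateAt W p) : CensusQ6.GordOddFirstUnitIndexAt W p 1 := by
  have hodd : ¬ Even (p / 2) := by rw [Nat.not_even_iff_odd]; exact ⟨p / 4, by omega⟩
  intro V _ _ C hV hC N _ f hf ϖ hϖ
  have hC' : C • V.quadraticTwist ((-1 : ℚ) ^ (p / 2) * p) = W := by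
    rw [pStar_eq_neg_of_mod_four_eq_three hp4]; exact hC
  obtain ⟨h0, h1⟩ := hcert V C hC' hV f hf ϖ (by rw [if_neg hodd]; exact hϖ)
  rw [if_neg hodd] at h0 h1
  refine ⟨fun m hm ↦ ?_, h1⟩
  obtain rfl : m = 0 := by omega
  rw [PowerSeries.coeff_zero_eq_constantCoeff_apply, h0, norm_zero]
  exact zero_lt_one

/-- **ODD branch, `L(E,1) = 0`: the Q6 record at index `1` and the certificate are ONE datum** —
`CensusQ6.GordOddFirstUnitIndexAt W p 1 ↔ BranchUnitCertificateAt W p`, Pal-free (PREDICTIONS-Q6 §5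
PASS(E,p) at `n₀ = 1` ↔ additive-p2's `hcert` on the odd (G-ord) rank-`≥ 1` rows).
[cite: MazurTateTeitelbaum1986Invent, §I.13–I.14] -/
theorem gordOddFirstUnitIndexAt_one_iff_branchUnitCertificateAt
    (hmod : hasEntireLFunction_rat) (hp4 : p % 4 = 3) (hadd : Addv W p) (hL : W.entireLFunction 1 = 0) :
    CensusQ6.GordOddFirstUnitIndexAt W p 1 ↔ BranchUnitCertificateAt W p :=
  ⟨branchUnitCertificateAt_of_gordOddFirstUnitIndexAt_one_of_mod_four_eq_three hmod hp4 hadd hL,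
    gordOddFirstUnitIndexAt_one_of_branchUnitCertificateAt hp4⟩

/-- **ODD branch, `r_an ≠ 0` rows** (so `L(E,1) = 0` by modularity): record at index `1` ⟺ certificate,
Pal-free. [cite: MazurTateTeitelbaum1986Invent, §I.13–I.14] -/
theorem gordOddFirstUnitIndexAt_one_iff_branchUnitCertificateAt_of_analyticRank_ne_zero
    (hmod : hasEntireLFunction_rat) (hp4 : p % 4 = 3) (hadd : Addv W p) (hr : W.analyticRank ≠ 0) :
    CensusQ6.GordOddFirstUnitIndexAt W p 1 ↔ BranchUnitCertificateAt W p :=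
  gordOddFirstUnitIndexAt_one_iff_branchUnitCertificateAt hmod hp4 hadd
    (entireLFunction_one_eq_zero_of_analyticRank_ne_zero hmod hr)

/-! ### §2 EVEN branch (`p ≡ 1 (mod 4)`): the converse is Pal-free; the iff carries `hPal` -/

omit [W.IsElliptic] [W.IsGloballyMinimal] in
/-- **Conversely (even branch): the certificate ⟹ the Q6 record at index `1`** — NO `L(E,1)`, NO Pal.
[cite: MazurTateTeitelbaum1986Invent, §I.13–I.14] -/
theorem gordFirstUnitIndexAt_one_of_branchUnitCertificateAt (hp4 : p % 4 = 1)
    (hcert : BranchUnitCertificateAt W p) : CensusQ6.GordFirstUnitIndexAt W p 1 := by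
  have heven : Even (p / 2) := ⟨p / 4, by omega⟩
  intro V _ _ C hV hC N _ f hf ϖ hϖ
  have hC' : C • V.quadraticTwist ((-1 : ℚ) ^ (p / 2) * p) = W := by
    rw [pStar_eq_self_of_mod_four_eq_one hp4]; exact hC
  obtain ⟨h0, h1⟩ := hcert V C hC' hV f hf ϖ (by rw [if_pos heven]; exact hϖ)
  rw [if_pos heven] at h0 h1
  refine ⟨fun m hm ↦ ?_, h1⟩
  obtain rfl : m = 0 := by omega
  rw [PowerSeries.coeff_zero_eq_constantCoeff_apply, h0, norm_zero]
  exact zero_lt_one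

/-- **EVEN branch, `L(E,1) = 0`: `CensusQ6.GordFirstUnitIndexAt W p 1 ↔ BranchUnitCertificateAt W p`**
(the forward direction is census-ctyper1's interlock and needs Pal 2012 Thm. 3.2 `hPal` for the
constant term; the converse is Pal-free). [cite: MazurTateTeitelbaum1986Invent, §I.13–I.14]
[cite: Pal2012, Thm. 3.2] -/
theorem gordFirstUnitIndexAt_one_iff_branchUnitCertificateAt
    (hPal : Pal2012.thm32_sqrt_mul_realPeriodRat_twist_eq_of_prime_one_mod_four)
    (hmod : hasEntireLFunction_rat) (hp4 : p % 4 = 1) (hadd : Addv W p) (hL : W.entireLFunction 1 = 0) :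
    CensusQ6.GordFirstUnitIndexAt W p 1 ↔ BranchUnitCertificateAt W p :=
  ⟨branchUnitCertificateAt_of_gordFirstUnitIndexAt_one hPal hmod hp4 hadd hL,
    gordFirstUnitIndexAt_one_of_branchUnitCertificateAt hp4⟩

/-- **EVEN branch, `r_an ≠ 0` rows**: record at index `1` ⟺ certificate (given `hPal`).
[cite: MazurTateTeitelbaum1986Invent, §I.13–I.14] [cite: Pal2012, Thm. 3.2] -/
theorem gordFirstUnitIndexAt_one_iff_branchUnitCertificateAt_of_analyticRank_ne_zero
    (hPal : Pal2012.thm32_sqrt_mul_realPeriodRat_twist_eq_of_prime_one_mod_four)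
    (hmod : hasEntireLFunction_rat) (hp4 : p % 4 = 1) (hadd : Addv W p) (hr : W.analyticRank ≠ 0) :
    CensusQ6.GordFirstUnitIndexAt W p 1 ↔ BranchUnitCertificateAt W p :=
  gordFirstUnitIndexAt_one_iff_branchUnitCertificateAt hPal hmod hp4 hadd
    (entireLFunction_one_eq_zero_of_analyticRank_ne_zero hmod hr)

/-! ### §3 The Pal-free ODD two-record node on X4♯(G-ord) ∩ `I₀*` ∩ {`ρ̄` onto} -/

/-- **TWO-RECORD NODE, (G-ord), `p ≡ 3 (mod 4)`, `p ≥ 7`, `r_an = 1`, non-anomalous, Pal-free** (twin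
of census-ctyper1's `ClassX4Gord.bsdp_of_censusX42_of_katoHalf_of_gordFirstUnitIndexAt_one_odd` WITHOUT
the idle `hPal`): the Q6 odd record `CensusQ6.GordOddFirstUnitIndexAt W p 1` (CERTIFICATE-EVIDENCE) +
the typed census relation `CensusX42.RelationAt W p Dh` (CANDIDATE) AT THE PAIR + Kato's half-eigen
divisibility `hK` + modularity + GZK + a (B)-datum `Dh` + `L'(E,1) = q·Ω_E·Reg_∞` ⟹ `BSD(E,p)`.
EVIDENCE-conditional; nothing booked. [cite: Kato2004Asterisque, Thm. 17.4 (3) (p. 273)]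
[cite: Delbourgo2002, Theorem (B) (p. 40)] [cite: Miller2011LMS, Def. 1.1] -/
theorem ClassX4Gord.bsdp_of_censusX42_of_katoHalf_of_gordOddFirstUnitIndexAt_one
    (hK : Wuthrich2014.kato_halfEigenCharIdeal_dvd_cyclotomicPrime_of_surjective)
    (hmodD : nonempty_modularParametrizationData)
    (hGZK : rank_eq_analyticRank_of_analyticRank_le_one) (hmod : hasEntireLFunction_rat)
    (hX : ClassX4Gord W p) (hp5 : 5 ≤ p) (hp4 : p % 4 = 3) (he : semistabilityIndex W p = 2)
    (hsurj : Surj W p) (hr : W.analyticRank = 1) (hna : ReductionNonAnomalous W p)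
    (hrec : CensusQ6.GordOddFirstUnitIndexAt W p 1)
    {Dh : PAdicHeightData W p} (hB : LeadingTermClauses W p Dh) (hrel : CensusX42.RelationAt W p Dh)
    {q : ℚ} (hLq : W.leadingLCoeff = (q : ℂ) * (W.realPeriodRat : ℂ) * (W.regulator : ℂ)) :
    BSDp W p :=
  hX.bsdp_of_censusX42_of_katoHalf_of_cert hK hmodD hGZK hmod hp5 he hsurj hr hna
    (branchUnitCertificateAt_of_gordOddFirstUnitIndexAt_one_of_mod_four_eq_three hmod hp4 hX.addv.2
      (entireLFunction_one_eq_zero_of_analyticRank_ne_zero hmod (by rw [hr]; exact one_ne_zero)) hrec)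
    hB hrel hLq

/-- **`p = 3` reading of §1** (O7-ord@3 ∩ (G-ord, `e = 2`), `r_an ≠ 0`): the Q6 odd record
`CensusQ6.GordOddFirstUnitIndexAt W 3 1` ⟺ `BranchUnitCertificateAt W 3` — the `hcert` of n1011-p12's
`…_three_iff_…_of_cert` family — Pal-free. [cite: MazurTateTeitelbaum1986Invent, §I.13–I.14] -/
theorem gordOddFirstUnitIndexAt_three_one_iff_branchUnitCertificateAt_of_analyticRank_ne_zero
    {W : WeierstrassCurve ℚ} [W.IsElliptic] [W.IsGloballyMinimal] [Fact (Nat.Prime 3)]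
    (hmod : hasEntireLFunction_rat) (hadd : Addv W 3) (hr : W.analyticRank ≠ 0) :
    CensusQ6.GordOddFirstUnitIndexAt W 3 1 ↔ BranchUnitCertificateAt W 3 :=
  gordOddFirstUnitIndexAt_one_iff_branchUnitCertificateAt_of_analyticRank_ne_zero hmod (by norm_num)
    hadd hr

end Summit.BirchSwinnertonDyer.Rank1Residual.Additive

end
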